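import Summits.QuantumFields.BalabanUV.Beta.D1BFx.ReducedKernelPackDiff

/-!
# `BalabanUV.Beta.D1BFx.ReducedTableAdd` — road «BF-x» for binder row D1, slot (K), (L3) «ΔΛ-ROWS» FILE 1b: **THE REDUCED TABLE IS ADDITIVE**
# (`tableRed n (Wf + Wf′) = tableRed n Wf + tableRed n Wf′` on bi-localised tables) — so the ONE rest member `restΔ` IS the four (L2) words
# UNCONDITIONALLY (`ReducedKernelPackDiff.restΔ_eq_words` with its displayed `hadd` and the two `Loc` sockets DISCHARGED)

HONEST DEPENDENCY (page 1, mandatory): continuum YM on T⁴ ⇐ BetaPertH ∧ nine spine estimates (0/9 proved); BetaPertH ⇐ (D1) ∧ (D4) ∧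
CAP+tail; G-an2-4 gates asym, D1 and NE2/3/4.  HONEST FRAMING (cell contract, verbatim): «discharging `BetaPertH` makes Bałaban's UV
stability UNCONDITIONAL — a real constructive-QFT result; it is NOT the continuum limit and NOT the Clay problem.»  THIS MODULE DISCHARGES
NOTHING of the wall: [folklore] `tsum` linearity BY NAME — `ChartConjugationReflection.wsum_add` twice (inner superposition over the second bond,
outer over the first), the absolute summability of the `ℋ`-weights `GluonKernelSectors.summable_abs_wH`, the uniform bound of the inner
superposition `ReducedTableBridge.exists_bound_inner`, `GluonKernelSectors.abs_le_of_biLoc`; then FILE 1's census with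
`ReducedTableBridge.vertexFamily₂_tableRed'` for the `Loc` sockets.  No definition, no `def … : Prop`, nothing cited, 0 sorry.  0 wall binders;
(K) NOT closed; NOT D1, NOT `BetaPertH`, NOT continuum, NOT Clay.

ABSOLUTE RULE (cell charter, verbatim): «No internally-minted statement may enter as a cited fact. Every hypothesis is either kernel-proved in
this package or a verbatim quotation of a PUBLISHED theorem with page reference. The manuscript(s) under audit are NOT citable for their own
disputed steps — they are the thing under adjudication; programme-internal (2001/route/tribunal) claims are never citable.»

CONTENT ([folklore]; `n` the block side, `[NeZero n]`).
* §1 `abs_inner_sum_le` (the colour-summed inner superposition is uniformly bounded), **`tableRed_add`** (bi-localised `Wf`, `Wf′` at one rate `δ > 0`).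
* §2 `loc_tableRed` (each entry of `tableRed n Wf` is localised), **`restΔ_eq_words'`** — `ReducedKernelPackDiff.restΔ_eq_words` with `hadd`, `hRW`,
  `hRW′` discharged: `restΔ n a S T Wf Wf′ μ ν z = −½·bubble G (vR S μ 0)(vR T ν z) − ½·bubble G (vR T μ 0)(vR S ν z) − ½·bubble G (vR T μ 0)(vR T ν z)
  + ½·tadpole G (tableRed n Wf′ μ 0 ν z)` under `Spr (Ga n a)` and the four families' localisation ONLY.
Unit `b2b-balaban-gan24-formalise-leaf-05` (gen 49), G-an2-4 swarm leaf prover on road «BF-x» (L3); no existing file touched.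
-/

noncomputable section

namespace Summit.QuantumFields.BalabanUV.Beta.D1BFx.ReducedTableAdd

open Finset
open scoped BigOperators
open Literature.MathematicalPhysics.QuantumFieldTheory
open Literature.MathematicalPhysics.QuantumFieldTheory.Balaban1983to89
open Literature.MathematicalPhysics.QuantumFieldTheory.Balaban1983to89.Beta
open B12Sec2to5 (l1)
open ExpKernelCalculus (Site MKer BiLoc bubble tadpole)
open KernelSpecInstance (wH)
open OneStepResolventKernel (wsum)
open Summit.QuantumFields.BalabanUV.Beta.TameKernelCalculus (Spr Loc)
open Summit.QuantumFields.BalabanUV.Beta.ChartConjugationReflection (wsum_add)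
open Summit.QuantumFields.BalabanUV.Beta.D1BFx.GluonLeg (Ga)
open Summit.QuantumFields.BalabanUV.Beta.D1BFx.ReducedKernel (StencilR vertexRed)
open Summit.QuantumFields.BalabanUV.Beta.D1BFx.DressedTadpoleTable (Table₂R tableRed)
open Summit.QuantumFields.BalabanUV.Beta.D1BFx.GluonKernelSectors (summable_abs_wH)
open Summit.QuantumFields.BalabanUV.Beta.D1BFx.ReducedTableBridge (tableRed_apply exists_bound_inner vertexFamily₂_tableRed')
open Summit.QuantumFields.BalabanUV.Beta.D1BFx.ReducedKernelPackDiff (restΔ restΔ_eq_words biLoc_table_add)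

variable (n : ℕ) [NeZero n] {Wf Wf' : Table₂R} {C2 C2' δ : ℝ}

/-! ## §1 Additivity of the reduced table -/

/-- [folklore] The colour-summed inner superposition `u ↦ (x z a b ↦ Σ_{λ′} Σ′_{u′} ℋ_{(λ′,u′),(ν,y′)}·Wf κ′ u λ′ u′ x z a b)` is bounded UNIFORMLY in
`u` and in the entry (four times `ReducedTableBridge.exists_bound_inner`'s bound). -/
theorem abs_inner_sum_le (hW : ∀ κ' u l' u', BiLoc (Wf κ' u l' u') u u' C2 δ) (hδ : 0 < δ) (ν : Fin 4) (y' : Site 4) :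
    ∃ B : ℝ, ∀ (κ' : Fin 4) (u x z : Site 4) (a b : Fin 4),
      |(fun x z a b => ∑ l' : Fin 4, wsum (fun u' => wH (N := n) (d := 3) l' ν (u' - (n : ℤ) • y')) (Wf κ' u l') x z a b) x z a b|
        ≤ B := by
  obtain ⟨B, hB⟩ := exists_bound_inner n hW hδ ν y'
  refine ⟨∑ _l' : Fin 4, B, fun κ' u x z a b => (Finset.abs_sum_le_sum_abs _ _).trans (Finset.sum_le_sum fun l' _ => hB κ' l' u x z a b)⟩

/-- [folklore] **THE REDUCED TABLE IS ADDITIVE** on bi-localised second-order table families (one rate `δ > 0`):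
`tableRed n (Wf + Wf′) μ y ν y′ = tableRed n Wf μ y ν y′ + tableRed n Wf′ μ y ν y′` — `wsum_add` on the inner superposition (weights
`ℋ_{(λ′,·),(ν,y′)}` absolutely summable, tables bounded by their `BiLoc` constants) and on the outer one (inner superpositions uniformly bounded). -/
theorem tableRed_add (hW : ∀ κ' u l' u', BiLoc (Wf κ' u l' u') u u' C2 δ) (hW' : ∀ κ' u l' u', BiLoc (Wf' κ' u l' u') u u' C2' δ) (hδ : 0 < δ)
    (μ : Fin 4) (y : Site 4) (ν : Fin 4) (y' : Site 4) :
    tableRed n (fun κ v l v' => Wf κ v l v' + Wf' κ v l v') μ y ν y' = tableRed n Wf μ y ν y' + tableRed n Wf' μ y ν y' := by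
  -- uniform bounds of the two tables and of the two inner superpositions
  have hB2 : ∀ (κ' : Fin 4) (u : Site 4) (l' : Fin 4) (u' x z : Site 4) (a b : Fin 4), |Wf κ' u l' u' x z a b| ≤ max C2 C2' := by
    intro κ' u l' u' x z a b
    have hC : 0 ≤ C2 := (hW κ' u l' u').nonneg a
    refine ((hW κ' u l' u' x z a b).trans (mul_le_of_le_one_right hC ?_)).trans (le_max_left _ _)
    exact Real.exp_le_one_iff.2 (by nlinarith [B12Sec2to5.l1_nonneg (x - u), B12Sec2to5.l1_nonneg (z - u'), hδ.le])
  have hB2' : ∀ (κ' : Fin 4) (u : Site 4) (l' : Fin 4) (u' x z : Site 4) (a b : Fin 4), |Wf' κ' u l' u' x z a b| ≤ max C2 C2' := by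
    intro κ' u l' u' x z a b
    have hC : 0 ≤ C2' := (hW' κ' u l' u').nonneg a
    refine ((hW' κ' u l' u' x z a b).trans (mul_le_of_le_one_right hC ?_)).trans (le_max_right _ _)
    exact Real.exp_le_one_iff.2 (by nlinarith [B12Sec2to5.l1_nonneg (x - u), B12Sec2to5.l1_nonneg (z - u'), hδ.le])
  obtain ⟨B, hB⟩ := abs_inner_sum_le n hW hδ ν y'
  obtain ⟨B', hB'⟩ := abs_inner_sum_le n hW' hδ ν y'
  -- inner additivity, as an identity of kernel-valued families of the first bond `u`
  have hin : ∀ κ' : Fin 4,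
      (fun u => fun x z a b => ∑ l' : Fin 4, wsum (fun u' => wH (N := n) (d := 3) l' ν (u' - (n : ℤ) • y'))
          ((fun κ v l v' => Wf κ v l v' + Wf' κ v l v') κ' u l') x z a b)
        = fun u => (fun x z a b => ∑ l' : Fin 4, wsum (fun u' => wH (N := n) (d := 3) l' ν (u' - (n : ℤ) • y')) (Wf κ' u l') x z a b)
            + (fun x z a b => ∑ l' : Fin 4, wsum (fun u' => wH (N := n) (d := 3) l' ν (u' - (n : ℤ) • y')) (Wf' κ' u l') x z a b) := by
    intro κ'
    funext u x z a b
    simp only [Pi.add_apply, ← Finset.sum_add_distrib]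
    refine Finset.sum_congr rfl fun l' _ => ?_
    have h := wsum_add (w := fun u' => wH (N := n) (d := 3) l' ν (u' - (n : ℤ) • y')) (S := Wf κ' u l') (T := Wf' κ' u l')
      (summable_abs_wH n l' ν y') (fun u' x z a b => hB2 κ' u l' u' x z a b) (fun u' x z a b => hB2' κ' u l' u' x z a b)
    exact congrFun (congrFun (congrFun (congrFun h x) z) a) b
  -- outer additivity
  funext x z a b
  simp only [tableRed_apply, Pi.add_apply, ← Finset.sum_add_distrib]
  refine Finset.sum_congr rfl fun κ' _ => ?_
  have hBB : ∀ (u x z : Site 4) (a b : Fin 4),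
      |(fun x z a b => ∑ l' : Fin 4, wsum (fun u' => wH (N := n) (d := 3) l' ν (u' - (n : ℤ) • y')) (Wf κ' u l') x z a b) x z a b|
        ≤ max B B' := fun u x z a b => (hB κ' u x z a b).trans (le_max_left _ _)
  have hBB' : ∀ (u x z : Site 4) (a b : Fin 4),
      |(fun x z a b => ∑ l' : Fin 4, wsum (fun u' => wH (N := n) (d := 3) l' ν (u' - (n : ℤ) • y')) (Wf' κ' u l') x z a b) x z a b|
        ≤ max B B' := fun u x z a b => (hB' κ' u x z a b).trans (le_max_right _ _)
  have h := wsum_add (w := fun u => wH (N := n) (d := 3) κ' μ (u - (n : ℤ) • y))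
    (S := fun u => fun x z a b => ∑ l' : Fin 4, wsum (fun u' => wH (N := n) (d := 3) l' ν (u' - (n : ℤ) • y')) (Wf κ' u l') x z a b)
    (T := fun u => fun x z a b => ∑ l' : Fin 4, wsum (fun u' => wH (N := n) (d := 3) l' ν (u' - (n : ℤ) • y')) (Wf' κ' u l') x z a b)
    (summable_abs_wH n κ' μ y) hBB hBB'
  rw [hin κ']
  exact congrFun (congrFun (congrFun (congrFun h x) z) a) b

/-! ## §2 The ONE rest member IS the four (L2) words, unconditionally -/

/-- [folklore] Each entry of the reduced table of a bi-localised family is localised (`ReducedTableBridge.vertexFamily₂_tableRed'`). -/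
theorem loc_tableRed (hW : ∀ κ' u l' u', BiLoc (Wf κ' u l' u') u u' C2 δ) (hδ : 0 < δ) (μ : Fin 4) (y : Site 4) (ν : Fin 4) (y' : Site 4) :
    Loc (tableRed n Wf μ y ν y') := by
  obtain ⟨Cw2, δ2, hδ2, -, hV⟩ := vertexFamily₂_tableRed' n hW hδ
  exact ⟨(n : ℤ) • y, (n : ℤ) • y', Cw2, δ2, hδ2, hV μ y ν y'⟩

variable (a : ℝ) {S T : StencilR} {Cs Ct : ℝ}

/-- [folklore] **THE ONE REST MEMBER IS THE FOUR (L2) WORDS, UNCONDITIONALLY** — FILE 1's `restΔ_eq_words` with the reduced table's additivity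
(`tableRed_add`) and the two `Loc` sockets (`loc_tableRed`) DISCHARGED; displayed: `Spr (Ga n a)` and the four families' localisation at one rate. -/
theorem restΔ_eq_words' (hGa : Spr (Ga n a)) (hS : ∀ κ u, BiLoc (S κ u) u u Cs δ) (hT : ∀ κ u, BiLoc (T κ u) u u Ct δ)
    (hW : ∀ κ' u l' u', BiLoc (Wf κ' u l' u') u u' C2 δ) (hW' : ∀ κ' u l' u', BiLoc (Wf' κ' u l' u') u u' C2' δ) (hδ : 0 < δ)
    (μ ν : Fin 4) (z : Site 4) :
    restΔ n a S T Wf Wf' μ ν z =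
      -(1 / 2) * bubble (Ga n a) (vertexRed n S μ 0) (vertexRed n T ν z)
        + -(1 / 2) * bubble (Ga n a) (vertexRed n T μ 0) (vertexRed n S ν z)
        + -(1 / 2) * bubble (Ga n a) (vertexRed n T μ 0) (vertexRed n T ν z)
        + (1 / 2) * tadpole (Ga n a) (tableRed n Wf' μ 0 ν z) :=
  restΔ_eq_words n a hGa hS hT hδ (loc_tableRed n hW hδ) (loc_tableRed n hW' hδ) (tableRed_add n hW hW' hδ) μ ν z

end Summit.QuantumFields.BalabanUV.Beta.D1BFx.ReducedTableAdd

end
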